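import Summits.QuantumFields.YangMills.Theorems.FluctuationComparisonRegPrIntLS1aAlphaMemOfFullTriv
import Summits.QuantumFields.YangMills.Theorems.FluctuationComparisonRegPrIntLS1aAlphaMemCanonMajorantOfRows
import Literature.MathematicalPhysics.QuantumFieldTheory.Balaban1983to89.BalabanAdmissibleClassParams
import Literature.MathematicalPhysics.QuantumFieldTheory.Balaban1983to89.T3Thresholds
import Literature.MathematicalPhysics.QuantumFieldTheory.Balaban1983to89.T3InteriorExcision
import HarnessLib

/-!
# S1a · UV3-NODE §69.12 — THE (m2) DOOR's SCHEDULE IS ADMISSIBLE: ONE height-indexed `prm : ℕ → ClassParams` with `AdmissibleClassParams F γ (b₀∕2) p₀ prm`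
# into which the door's explicit `(K, k)`-record RELAXES at `β := β_K` — the `∃ prm, AdmissibleClassParams …` conjunct of S1a(ᴴ) (m) discharged by kernel

Cell `ym3-torus` (YM ladder rung R3 = continuum `SU(2)` Yang–Mills on the three-torus — a RUNG: NOT d = 4, NOT infinite volume, NOT a mass gap, NOT Clay).
Width seat «width 8» `ym3-torus-px8` (gen 24), FREE px helper on crux `stmt-QuantumFields-20520`, count-neutral, DEFINITION-FREE, default heartbeats.

WHY.  S1aᴴ ∕ S1a (m) (`Lines/runpair_organ.lean` :363) read `∃ prm : ℕ → ClassParams, AdmissibleClassParams F γ b₀ p₀ prm ∧ ∀ K …, MemOfRun F ℰp hjK (prm j) (e^κ·ρ j)`: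
ONE schedule per HEIGHT, chosen BEFORE the run `K`.  The (m2) door (✓`…S1aAlphaMemCanonVersionOfRows.mem_canonVersion_of_alphaRows`, ✓`…MemOfFullTriv`, ✓`…MemCanonMajorantOfRows`)
delivers `BalabanUVClass.Mem (blockAvg ℰp) prm′(K,k) (e^{E_k}·canonVersion dU_k (orbAvg ρ_k))` with an EXPLICIT record `prm′(K,k)`: `δ := θBal(K−k)`, `β := β_K`, `κ := κ₁`,
`M := 2r+18M₁+3+CD`, `Ccov := max C 0·θBal(K−k+1)²·(2·max C′ 0·(7+2r+18M₁)³)`, `cE := 0`, `slack := Rm K k`, and `δreg δL cLF c5` free.  This file checks that record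
against the eleven clauses of `BalabanUVClass.AdmissibleClassParams` ([Balaban1985UV3] (5), (7), (25), (41), (45)–(47), (65)–(71)):
* the all-small window clause `2θ(j) ≤ δ_j` costs HALF of `b₀` (`θBal` is linear in `b₀`, lit ✓`T3InteriorExcision.θBal_mul`): the schedule is admissible at `b₀∕2` for a
  door run at `b₀` — S1aᴴ's `∃ b₀` absorbs it;
* `Ccov ∝ θBal(K−k+1)² ≤ θBal(K−k)²` by lit ✓`T3Thresholds.θBal_succ_le` (`√γ ≤ e^{1−p₀}`);
* `slack := Rm K k ≤ S₀·q^{K−k}` with `S₀ = max C 0·(2L^m)³∕(1−q)` from the socket's `RmSize D C q` ((41) p.266 last term, geometric in the HEIGHT);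
* `β`: `ClassParams.Weaker` never moves `β`, so the run-`K` coefficient is kept as `{prm (K−k) with β := β_K}` — EXACTLY the (R-β1′) reading `(prm n).β·L^{K−n} = Lⁿ∕γ·L^{K−n}
  = L^K∕γ = β_K` (§3 `pow_div_mul_pow_eq_beta`, `rfl`-level); before (R-β1′) lands `MemOfRun … (prm j)` cannot be fed at `K ≠ j` (UV3-NODE §69.3, RULING №80).

WHAT (0 `def`, 0 `sorry`; nothing of Bałaban's asserted).
§1 ★★ `admissible_schedule` (the halving `θBal(b₀∕2) = θBal(b₀)∕2` inlined from lit ✓`θBal_mul`; as a named lemma it is ✓`SmallFieldWideningPlainStabAddOfLocalStep.θBal_half`, cited not restated) — for `0 < γ ≤ 1`, `√γ ≤ e^{1−p₀}`, `0 ≤ b₀`, `0 ≤ p₀`, `0 < κ₁`, `0 < R₀`, `0 ≤ q < 1`: the schedule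
`n ↦ ⟨θBal(b₀,n), R₀, θBal(b₀,n), Lⁿ∕γ, κ₁, M₀, A·θBal(b₀,n)², 0, S₀·qⁿ, ¼p_{b₀∕2}(g_n)², C₅⟩` is `AdmissibleClassParams F γ (b₀∕2) p₀`.
§2 `Rm_le_geom_height` — `RmSize D C q ⇒ Rm K k ≤ (max C 0·(2L^m)³∕(1−q))·q^{K−k}`; ★★ `weaker_door_schedule` — the door's record at `(K,k)` (free fields set to the schedule's)
is STRONGER (`ClassParams.Weaker`) than `{schedule (K−k) with β := β_K}`; `mem_schedule_of_mem_door` — lit ✓`Mem.relax`.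
§3 ★★★ `mem_schedule_of_alphaFullTriv` — ✓`…MemOfFullTriv`'s hypotheses (package `AlphaInputsT3ACFullTriv` BY NAME + numerics + the six §69.11 binders with the free fields pinned
to the schedule) ⟹ membership of `e^{E_k}·canonVersion dU_k (orbAvg ρ_k)` in `{schedule (K−k) with β := β_K}` for the package's OWN `(κ₁, C, C′, q)`; ★★★ `exists_admissible_schedule_mem`
— the S1aᴴ (m)-SHAPED statement: `∃ prm, AdmissibleClassParams F γ (b₀∕2) p₀ prm ∧ ∀ K k ≤ K, ⟨binders at (K,k)⟩ → Mem (blockAvg ℰp) {prm (K−k) with β := β_K} (…)`;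
`pow_div_mul_pow_eq_beta` — the (R-β1′) dock `Lⁿ∕γ·L^{K−n} = (F.scheme ℰp γ).β K`.

WHAT THIS FILE IS NOT: a discharge of any of the six binders (`hwin`, `hlowc`, `hupc`∕majorant, `hRegClass`, `hlfle`, `hlarge`); the `readAtLevel`∕`MemOfRun` reading (after (R-β1′));
nothing of Bałaban's asserted or proved; the (α) package for the actual runs UNINHABITED; crux 20520, 19936, 19200, `YM3TorusSU2` NOT proved; no registered stub closed;
rung R3 = SU(2) YM₃ on T³ — NOT d = 4, NOT infinite volume, NOT a mass gap, NOT Clay.  Sorry-free, axioms standard.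

References: T. Bałaban, CMP **102** (1985) 255–275 [Balaban1985UV3] ((5) p.256, (7) p.257, (25) p.262, (41)–(47) pp.266–267, (65)–(71) p.273).
-/

set_option autoImplicit false

noncomputable section

namespace Summit.QuantumFields.YangMills.Theorems.FluctuationComparisonRegPrIntLS1aAlphaAdmissibleSchedule

open Finset MeasureTheory
open scoped BigOperators
open Literature.MathematicalPhysics.QuantumFieldTheory.Balaban1983to89
open T3ContinuumYM3Torus T3UnitScaleTilt T3UnitLawDensityEML T3RestrictedUnitDensity T3AlphaInputsAC T3AlphaInputsACSchemas T3AlphaInputsACTrivRows BalabanUVClass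
open T3Thresholds (θBal_succ_le)
open T3InteriorExcision (θBal_mul)
open Literature.MathematicalPhysics.QuantumFieldTheory.Balaban1983to89.Node00 (regSet canonVersion)
open Literature.MathematicalPhysics.QuantumFieldTheory.Balaban1983to89.T3OrbitAverage (orbAvg)
open Summit.QuantumFields.YangMills.Theorems.FluctuationComparisonRegPrIntLS1aAlphaMemCanonVersionOfRows (mem_canonVersion_of_alphaRows)
open Summit.QuantumFields.YangMills.Theorems.FluctuationComparisonRegPrIntLS1aAlphaMemCanonMajorantOfRows (mem_canonVersion_of_alphaRows_majorant)

variable {F : T3Family} {γ : ℝ}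

/-! ## §1 The height schedule and its admissibility at `b₀∕2` -/

/-- ★★ **THE HEIGHT SCHEDULE IS ADMISSIBLE AT `b₀∕2`**: window and large threshold `θBal(b₀, n) = 2θBal(b₀∕2, n)`, regular window `R₀`, coefficient `Lⁿ∕γ`, decay `κ₁`,
diameter constant `M₀`, activity budget `A·θBal(b₀,n)²`, vacuum constant `0`, slack `S₀·qⁿ`, large-field exponent `¼p_{b₀∕2}(g_n)²`, stability constant `C₅`.
[cite: Balaban1985UV3, (5) p.256, (7) p.257, (25) p.262, (45)-(47) p.267, (65)-(71) p.273] -/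
theorem admissible_schedule (F : T3Family) {γ b₀ p₀ κ₁ R₀ q : ℝ} (hκ₁ : 0 < κ₁) (hR₀ : 0 < R₀) (hq0 : 0 ≤ q) (hq1 : q < 1) (M₀ A S₀ C₅ : ℝ) :
    AdmissibleClassParams F γ (b₀ / 2) p₀ (fun n =>
      { δ := θBal F.L γ b₀ p₀ n, δreg := R₀, δL := θBal F.L γ b₀ p₀ n, β := (F.L : ℝ) ^ n / γ, κ := κ₁, M := M₀,
        Ccov := A * θBal F.L γ b₀ p₀ n ^ 2, cE := 0, slack := S₀ * q ^ n,
        cLF := B10.pFun (b₀ / 2) p₀ (Real.sqrt (γ * ((F.L : ℝ)⁻¹) ^ n)) ^ 2 / 4, c5 := C₅ }) := by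
  -- `θBal` is linear in `b₀` (lit ✓`T3InteriorExcision.θBal_mul`; the halving identity is ✓`SmallFieldWideningPlainStabAddOfLocalStep.θBal_half`, cited not restated)
  have hhalf : ∀ n, θBal F.L γ (b₀ / 2) p₀ n = θBal F.L γ b₀ p₀ n / 2 := fun n => by
    rw [div_eq_inv_mul, θBal_mul, inv_mul_eq_div]
  exact
    { window := fun n => by rw [hhalf]; linarith
      regular := ⟨R₀, fun _ => ⟨hR₀, le_rfl⟩⟩
      largeThreshold := fun n => by show θBal F.L γ b₀ p₀ n ≤ _; rw [hhalf]; linarith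
      beta := fun _ => le_rfl
      decay := ⟨κ₁, hκ₁, fun _ => le_rfl⟩
      diam := ⟨M₀, fun _ => le_rfl⟩
      cover := ⟨4 * A, fun n => by show A * θBal F.L γ b₀ p₀ n ^ 2 ≤ _; rw [hhalf]; exact le_of_eq (by ring)⟩
      vacuum := ⟨0, fun _ => le_rfl⟩
      slack := ⟨S₀, q, hq0, hq1, fun _ => le_rfl⟩
      largeField := fun _ => le_rfl
      stability := ⟨C₅, fun _ => le_rfl⟩ }

/-! ## §2 The door's `(K, k)`-record relaxes into the schedule at height `K − k` -/

/-- **THE REMAINDER IS GEOMETRIC IN THE HEIGHT**: `RmSize D C q ⇒ Rm K k ≤ (max C 0·(2L^m)³∕(1−q))·q^{K−k}` ((41) p.266 last term «Σ_{j<k} O((Lʲε)^{3+κ₀})|T₁^{(j)}|»: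
every summand has `Lʲε ≤ L^{k−1}ε = L^{−(K−k+1)}`). [cite: Balaban1985UV3, (41) p.266 and (5) p.256] -/
theorem Rm_le_geom_height (D : AlphaDataT3 F γ) {C q : ℝ} (h : RmSize D C q) {K k : ℕ} (hk : k ≤ K) :
    D.Rm K k ≤ max C 0 * (2 * (F.L : ℝ) ^ F.m) ^ 3 / (1 - q) * q ^ (K - k) := by
  obtain ⟨hq0, hq1, hR⟩ := h
  have hV0 : 0 ≤ (2 * (F.L : ℝ) ^ F.m) ^ 3 := by positivity
  have h1q : 0 < 1 - q := by linarith
  -- every summand `q^{K−i}`, `i < k`, is `≤ q^{K−k}·q^{k−1−i}`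
  have hsum : ∑ i ∈ range k, q ^ (K - i) ≤ q ^ (K - k) * (1 - q)⁻¹ := by
    have hle : ∀ i ∈ range k, q ^ (K - i) ≤ q ^ (K - k) * q ^ (k - 1 - i) := by
      intro i hi
      have hik := mem_range.mp hi
      rw [← pow_add]
      exact pow_le_pow_of_le_one hq0 hq1.le (by omega)
    calc ∑ i ∈ range k, q ^ (K - i) ≤ ∑ i ∈ range k, q ^ (K - k) * q ^ (k - 1 - i) := sum_le_sum hle
      _ = q ^ (K - k) * ∑ i ∈ range k, q ^ (k - 1 - i) := by rw [mul_sum]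
      _ = q ^ (K - k) * ∑ i ∈ range k, q ^ i := by rw [sum_range_reflect (fun i => q ^ i) k]
      _ ≤ q ^ (K - k) * (1 - q)⁻¹ :=
          mul_le_mul_of_nonneg_left (sum_le_hasSum (range k) (fun n _ => pow_nonneg hq0 n) (hasSum_geometric_of_lt_one hq0 hq1))
            (pow_nonneg hq0 _)
  have hS0 : 0 ≤ ∑ i ∈ range k, q ^ (K - i) := sum_nonneg fun i _ => pow_nonneg hq0 _
  calc D.Rm K k ≤ C * (∑ i ∈ range k, q ^ (K - i)) * (2 * (F.L : ℝ) ^ F.m) ^ 3 := (hR K k hk).2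
    _ ≤ max C 0 * (∑ i ∈ range k, q ^ (K - i)) * (2 * (F.L : ℝ) ^ F.m) ^ 3 := by gcongr; exact le_max_left C 0
    _ ≤ max C 0 * (q ^ (K - k) * (1 - q)⁻¹) * (2 * (F.L : ℝ) ^ F.m) ^ 3 := by gcongr
    _ = max C 0 * (2 * (F.L : ℝ) ^ F.m) ^ 3 / (1 - q) * q ^ (K - k) := by rw [div_eq_mul_inv]; ring

/-- ★★ **THE DOOR's RECORD IS STRONGER THAN THE SCHEDULE RE-KEYED AT RUN `K`** (height `n = K − k`; the door's free fields `δreg, δL, cLF, c5` pinned to the schedule's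
values; `A := max C 0·(2·max C′ 0·(7+2r+18M₁)³)`, `S₀ := max C_R 0·(2L^m)³∕(1−q)`): `ClassParams.Weaker ⟨door (K,k)⟩ {schedule (K−k) with β := β_K}` — `δ, δreg, δL, β, κ, M,
cLF, c5` equal, `cE: 0 ≤ 0`, `Ccov` by `θBal(K−k+1) ≤ θBal(K−k)`, `slack` by `Rm_le_geom_height`. [cite: Balaban1985UV3, (5) p.256, (7) p.257, (41) p.266, (45)-(46) p.267] -/
theorem weaker_door_schedule (D : AlphaDataT3 F γ) {b₀ p₀ C C' r CD C_R q : ℝ} {M₁ : ℕ} (hγ : 0 < γ) (hγ1 : γ ≤ 1)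
    (hγe : Real.sqrt γ ≤ Real.exp (1 - p₀)) (hb : 0 ≤ b₀) (hp : 0 ≤ p₀) (hr : 0 ≤ r) (hRm : RmSize D C_R q) {K k : ℕ} (hk : k ≤ K)
    (κ₁ R₀ C₅ β : ℝ) :
    ClassParams.Weaker
      { δ := θBal F.L γ b₀ p₀ (K - k), δreg := R₀, δL := θBal F.L γ b₀ p₀ (K - k), β := β, κ := κ₁, M := 2 * r + 18 * M₁ + 3 + CD,
        Ccov := max C 0 * θBal F.L γ b₀ p₀ (K - k + 1) ^ 2 * (2 * max C' 0 * (7 + 2 * r + 18 * M₁) ^ 3), cE := 0, slack := D.Rm K k,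
        cLF := B10.pFun (b₀ / 2) p₀ (Real.sqrt (γ * ((F.L : ℝ)⁻¹) ^ (K - k))) ^ 2 / 4, c5 := C₅ }
      { δ := θBal F.L γ b₀ p₀ (K - k), δreg := R₀, δL := θBal F.L γ b₀ p₀ (K - k), β := β, κ := κ₁, M := 2 * r + 18 * M₁ + 3 + CD,
        Ccov := max C 0 * (2 * max C' 0 * (7 + 2 * r + 18 * M₁) ^ 3) * θBal F.L γ b₀ p₀ (K - k) ^ 2, cE := 0,
        slack := max C_R 0 * (2 * (F.L : ℝ) ^ F.m) ^ 3 / (1 - q) * q ^ (K - k),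
        cLF := B10.pFun (b₀ / 2) p₀ (Real.sqrt (γ * ((F.L : ℝ)⁻¹) ^ (K - k))) ^ 2 / 4, c5 := C₅ } where
  δ_le := le_rfl
  δreg_eq := rfl
  δL_le := le_rfl
  β_eq := rfl
  κ_eq := rfl
  M_le := le_rfl
  Ccov_le := by
    have hL1 : 1 ≤ F.L := F.hL.2.le
    have hL0 : 0 < (F.L : ℝ) := by exact_mod_cast F.hL.2.le
    have hg0 : 0 < Real.sqrt (γ * ((F.L : ℝ)⁻¹) ^ (K - k + 1)) := Real.sqrt_pos.2 (mul_pos hγ (pow_pos (inv_pos.2 hL0) _))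
    have hθ0 : 0 ≤ θBal F.L γ b₀ p₀ (K - k + 1) :=
      mul_nonneg (Real.sqrt_nonneg _) (B10.pFun_nonneg _ _ _ hb hg0 (T3Thresholds.coupling_le_one hL1 hγ hγ1 _))
    have hθle : θBal F.L γ b₀ p₀ (K - k + 1) ≤ θBal F.L γ b₀ p₀ (K - k) := θBal_succ_le hL1 hγ hγ1 hγe hb hp (K - k)
    have hX : 0 ≤ 2 * max C' 0 * (7 + 2 * r + 18 * (M₁ : ℝ)) ^ 3 := by positivity
    show max C 0 * θBal F.L γ b₀ p₀ (K - k + 1) ^ 2 * (2 * max C' 0 * (7 + 2 * r + 18 * M₁) ^ 3) ≤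
      max C 0 * (2 * max C' 0 * (7 + 2 * r + 18 * M₁) ^ 3) * θBal F.L γ b₀ p₀ (K - k) ^ 2
    rw [mul_right_comm]
    exact mul_le_mul_of_nonneg_left (pow_le_pow_left₀ hθ0 hθle 2) (mul_nonneg (le_max_right _ _) hX)
  cE_le := le_rfl
  slack_le := Rm_le_geom_height D hRm hk
  cLF_le := le_rfl
  c5_le := le_rfl

/-- **MEMBERSHIP TRANSFERS FROM THE DOOR's RECORD TO THE SCHEDULE** (lit ✓`Mem.relax`). [cite: Balaban1985UV3, (5) pp.256-257] -/
theorem mem_schedule_of_mem_door (D : AlphaDataT3 F γ) {b₀ p₀ C C' r CD C_R q : ℝ} {M₁ : ℕ} (hγ : 0 < γ) (hγ1 : γ ≤ 1)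
    (hγe : Real.sqrt γ ≤ Real.exp (1 - p₀)) (hb : 0 ≤ b₀) (hp : 0 ≤ p₀) (hr : 0 ≤ r) (hRm : RmSize D C_R q) {K k : ℕ} (hk : k ≤ K)
    (κ₁ R₀ C₅ β : ℝ) {f : GaugeField (F.P K) k (Matrix.specialUnitaryGroup (Fin 2) ℂ) → ℝ}
    (hf : Mem (P := F.P K) (k := k) (fun i => BlockAveraging.blockAvg (P := F.P K) (j := i) ℰp)
      { δ := θBal F.L γ b₀ p₀ (K - k), δreg := R₀, δL := θBal F.L γ b₀ p₀ (K - k), β := β, κ := κ₁, M := 2 * r + 18 * M₁ + 3 + CD,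
        Ccov := max C 0 * θBal F.L γ b₀ p₀ (K - k + 1) ^ 2 * (2 * max C' 0 * (7 + 2 * r + 18 * M₁) ^ 3), cE := 0, slack := D.Rm K k,
        cLF := B10.pFun (b₀ / 2) p₀ (Real.sqrt (γ * ((F.L : ℝ)⁻¹) ^ (K - k))) ^ 2 / 4, c5 := C₅ } f) :
    Mem (P := F.P K) (k := k) (fun i => BlockAveraging.blockAvg (P := F.P K) (j := i) ℰp)
      { δ := θBal F.L γ b₀ p₀ (K - k), δreg := R₀, δL := θBal F.L γ b₀ p₀ (K - k), β := β, κ := κ₁, M := 2 * r + 18 * M₁ + 3 + CD,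
        Ccov := max C 0 * (2 * max C' 0 * (7 + 2 * r + 18 * M₁) ^ 3) * θBal F.L γ b₀ p₀ (K - k) ^ 2, cE := 0,
        slack := max C_R 0 * (2 * (F.L : ℝ) ^ F.m) ^ 3 / (1 - q) * q ^ (K - k),
        cLF := B10.pFun (b₀ / 2) p₀ (Real.sqrt (γ * ((F.L : ℝ)⁻¹) ^ (K - k))) ^ 2 / 4, c5 := C₅ } f :=
  hf.relax (weaker_door_schedule D hγ hγ1 hγe hb hp hr hRm hk κ₁ R₀ C₅ β)

/-! ## §3 The composed door: ONE admissible schedule, membership at every run -/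

/-- **THE (R-β1′) DOCK**: the schedule's coefficient times the reading's scale factor IS run `K`'s coefficient, `Lⁿ∕γ·L^{K−n} = (γ·L^{−K})⁻¹ = β_K` (`n ≤ K`).
[cite: Balaban1985UV3, (5) p.256 and (41) p.266] -/
theorem pow_div_mul_pow_eq_beta (F : T3Family) {γ : ℝ} {n K : ℕ} (hn : n ≤ K) :
    (F.L : ℝ) ^ n / γ * (F.L : ℝ) ^ (K - n) = (F.scheme ℰp γ).β K := by
  have hL : (F.L : ℝ) ≠ 0 := by have := F.hL.2; positivity
  show (F.L : ℝ) ^ n / γ * (F.L : ℝ) ^ (K - n) = (γ * ((F.L : ℝ)⁻¹) ^ K)⁻¹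
  rw [div_mul_eq_mul_div, ← pow_add, Nat.add_sub_cancel' hn, inv_pow, mul_inv, inv_inv, div_eq_inv_mul]

/-- ★★★ **THE (m2) DOOR INTO THE ADMISSIBLE SCHEDULE** (run `K`, level `k ≤ K`, height `K − k`): under `AlphaInputsT3ACFullTriv D W b₀ p₀ ε₀ C68 Cχ B₃ M₁ r CD`, the numerics
`0 < γ ≤ 1`, `√γ ≤ e^{1−p₀}`, `0 ≤ b₀`, `0 ≤ p₀`, `0 ≤ r`, `1 ≤ M₁`, `M₁ ∣ 2L^m`, `0 ≤ CD`, and the six displayed binders of ✓`…MemOfFullTriv` with the free fields PINNED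
(`δreg := R₀`, `δL := θBal(K−k)`, `cLF := ¼p_{b₀∕2}(g_{K−k})²`, `c5 := C₅`), the Γ-averaged canonical version of `e^{E_k}·ρ_k` is a member of the SCHEDULE's class at height
`K − k` re-keyed at `β := β_K`, for the package's own `(κ₁, C, C′)` and remainder data `(C_R, q)`. [cite: Balaban1985UV3, (41)-(47) pp.266-267, (5) p.256, (7) p.257] -/
theorem mem_schedule_of_alphaFullTriv {D : AlphaDataT3 F γ} (W : LFData D) {b₀ p₀ ε₀ C68 Cχ B₃ r CD R₀ C₅ : ℝ} {M₁ : ℕ} {K k : ℕ} (hk : k ≤ K)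
    (h : AlphaInputsT3ACFullTriv D W b₀ p₀ ε₀ C68 Cχ B₃ M₁ r CD) (hγ : 0 < γ) (hγ1 : γ ≤ 1) (hγe : Real.sqrt γ ≤ Real.exp (1 - p₀)) (hb : 0 ≤ b₀) (hp : 0 ≤ p₀)
    (hr : 0 ≤ r) (hM1 : 1 ≤ M₁) (hMdvd : M₁ ∣ 2 * F.L ^ F.m) (hCD : 0 ≤ CD)
    (hwin : {V : GaugeField (F.P K) k (Matrix.specialUnitaryGroup (Fin 2) ℂ) | PlaqSmall (θBal F.L γ b₀ p₀ (K - k)) V} ⊆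
      regSet (fieldMeasure (F.P K) k (Matrix.specialUnitaryGroup (Fin 2) ℂ)) (resDensity F γ K Set.univ k))
    (hlowc : ContinuousOn (D.low K k) {V | PlaqSmall (θBal F.L γ b₀ p₀ (K - k)) V})
    (hupc : ContinuousOn (D.up K k) {V | PlaqSmall (θBal F.L γ b₀ p₀ (K - k)) V})
    (hRegClass : ∀ V : GaugeField (F.P K) k (Matrix.specialUnitaryGroup (Fin 2) ℂ), PlaqSmall (θBal F.L γ b₀ p₀ (K - k)) V →
      IsBackground (fun i => BlockAveraging.blockAvg (P := F.P K) (j := i) ℰp) {U | PlaqSmall R₀ U} k V (D.Umin K k (D.triv K k) V))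
    (hlfle : ∀ V : GaugeField (F.P K) k (Matrix.specialUnitaryGroup (Fin 2) ℂ),
      Real.exp (D.Ecst K k) * (Real.exp (-(D.Ecst K k) + D.Rm K k) * (D.up K k V - D.low K k V)) ≤
        Real.exp (-(B10.pFun (b₀ / 2) p₀ (Real.sqrt (γ * ((F.L : ℝ)⁻¹) ^ (K - k))) ^ 2 / 4)) * Real.exp (C₅ * Fintype.card (Site (F.P K) k)))
    (hlarge : ∀ (V : GaugeField (F.P K) k (Matrix.specialUnitaryGroup (Fin 2) ℂ)) (S : Finset (Plaq (F.P K) k)),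
      (∀ p ∈ S, θBal F.L γ b₀ p₀ (K - k) ≤ GaugeGroup.dist1 (GaugeField.plaqHol V p)) →
        Real.exp (D.Ecst K k) *
            canonVersion (fieldMeasure (F.P K) k (Matrix.specialUnitaryGroup (Fin 2) ℂ)) (orbAvg (resDensity F γ K Set.univ k)) V ≤
          Real.exp (-(B10.pFun (b₀ / 2) p₀ (Real.sqrt (γ * ((F.L : ℝ)⁻¹) ^ (K - k))) ^ 2 / 4 * S.card)) *
            Real.exp (C₅ * Fintype.card (Site (F.P K) k))) :
    ∃ κ₁ C C' C_R q : ℝ, (TermSize D b₀ p₀ C κ₁ ∧ LocCover D κ₁ C' ∧ RmSize D C_R q) ∧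
      Mem (P := F.P K) (k := k) (fun i => BlockAveraging.blockAvg (P := F.P K) (j := i) ℰp)
        { δ := θBal F.L γ b₀ p₀ (K - k), δreg := R₀, δL := θBal F.L γ b₀ p₀ (K - k), β := (F.scheme ℰp γ).β K, κ := κ₁, M := 2 * r + 18 * M₁ + 3 + CD,
          Ccov := max C 0 * (2 * max C' 0 * (7 + 2 * r + 18 * M₁) ^ 3) * θBal F.L γ b₀ p₀ (K - k) ^ 2, cE := 0,
          slack := max C_R 0 * (2 * (F.L : ℝ) ^ F.m) ^ 3 / (1 - q) * q ^ (K - k),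
          cLF := B10.pFun (b₀ / 2) p₀ (Real.sqrt (γ * ((F.L : ℝ)⁻¹) ^ (K - k))) ^ 2 / 4, c5 := C₅ }
        (fun V => Real.exp (D.Ecst K k) *
          canonVersion (fieldMeasure (F.P K) k (Matrix.specialUnitaryGroup (Fin 2) ℂ)) (orbAvg (resDensity F γ K Set.univ k)) V) := by
  have hA := h.base
  obtain ⟨κ₁, C, C', hts, hLC⟩ := h.commonRate
  obtain ⟨⟨C_R, q, hRm⟩, -⟩ := hA.2.1
  refine ⟨κ₁, C, C', C_R, q, ⟨hts, hLC, hRm⟩, ?_⟩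
  have hdoor := mem_canonVersion_of_alphaRows D W hk hA.1.2.1 hA.1.2.2.1 hts hA.1.1 hA.admOnSmall hLC h.enlBounded h.locBlockVolume
    hA.2.2.2.2.2.1.2.1 hA.2.2.1 h.full.2.1 (hA.ineq47AE hk) (hA.ineq41AE hk) hr hM1 hMdvd hCD hγ.le hwin hlowc hupc
    (fun V hV => h.chiOneOnSmall K k V hk hV) (fun V v => h.trivWeight K k v V) (h.ztermTriv K k)
    (fun i _ _ Y hY => h.locBlockUnion K k (D.triv K k) i Y hY) (fun i _ _ Y hY x hx y hy => h.locDiam K k (D.triv K k) i Y hY x hx y hy)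
    h.enlContains hRegClass hlfle hlarge
  exact mem_schedule_of_mem_door D hγ hγ1 hγe hb hp hr hRm hk κ₁ R₀ C₅ _ hdoor

/-- ★★★ **THE S1aᴴ (m)-SHAPED STATEMENT** — ONE admissible height schedule, membership at EVERY run: under the package `AlphaInputsT3ACFullTriv …` and the numerics there is
`prm : ℕ → ClassParams` with `AdmissibleClassParams F γ (b₀∕2) p₀ prm` such that, for every run `K` and level `k ≤ K`, the six displayed binders at `(K, k)` (free fields
pinned: `δreg := R₀`, `δL := θBal(K−k)`, `cLF := (prm (K−k)).cLF = ¼p_{b₀∕2}(g_{K−k})²`, `c5 := C₅`) give membership of `e^{E_k}·canonVersion dU_k (orbAvg ρ_k)` in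
`{prm (K−k) with β := β_K}` — the run-`K` reading of the height-`(K−k)` class of the (R-β1′) repair (`(prm n).β·L^{K−n} = β_K`, `pow_div_mul_pow_eq_beta`).
[cite: Balaban1985UV3, (41)-(47) pp.266-267, (5) p.256, (7) p.257, (25) p.262, (65)-(71) p.273] -/
theorem exists_admissible_schedule_mem {D : AlphaDataT3 F γ} (W : LFData D) {b₀ p₀ ε₀ C68 Cχ B₃ r CD R₀ C₅ : ℝ} {M₁ : ℕ}
    (h : AlphaInputsT3ACFullTriv D W b₀ p₀ ε₀ C68 Cχ B₃ M₁ r CD) (hγ : 0 < γ) (hγ1 : γ ≤ 1) (hγe : Real.sqrt γ ≤ Real.exp (1 - p₀)) (hb : 0 ≤ b₀) (hp : 0 ≤ p₀)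
    (hr : 0 ≤ r) (hM1 : 1 ≤ M₁) (hMdvd : M₁ ∣ 2 * F.L ^ F.m) (hCD : 0 ≤ CD) (hR₀ : 0 < R₀) :
    ∃ prm : ℕ → ClassParams, AdmissibleClassParams F γ (b₀ / 2) p₀ prm ∧
      (∀ n, (prm n).δ = θBal F.L γ b₀ p₀ n ∧ (prm n).δreg = R₀ ∧ (prm n).δL = θBal F.L γ b₀ p₀ n ∧ (prm n).β = (F.L : ℝ) ^ n / γ ∧
        (prm n).cLF = B10.pFun (b₀ / 2) p₀ (Real.sqrt (γ * ((F.L : ℝ)⁻¹) ^ n)) ^ 2 / 4 ∧ (prm n).c5 = C₅ ∧ (prm n).cE = 0) ∧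
      ∀ (K k : ℕ) (hk : k ≤ K),
        {V : GaugeField (F.P K) k (Matrix.specialUnitaryGroup (Fin 2) ℂ) | PlaqSmall (θBal F.L γ b₀ p₀ (K - k)) V} ⊆
            regSet (fieldMeasure (F.P K) k (Matrix.specialUnitaryGroup (Fin 2) ℂ)) (resDensity F γ K Set.univ k) →
        ContinuousOn (D.low K k) {V | PlaqSmall (θBal F.L γ b₀ p₀ (K - k)) V} →
        ContinuousOn (D.up K k) {V | PlaqSmall (θBal F.L γ b₀ p₀ (K - k)) V} →
        (∀ V : GaugeField (F.P K) k (Matrix.specialUnitaryGroup (Fin 2) ℂ), PlaqSmall (θBal F.L γ b₀ p₀ (K - k)) V →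
          IsBackground (fun i => BlockAveraging.blockAvg (P := F.P K) (j := i) ℰp) {U | PlaqSmall R₀ U} k V (D.Umin K k (D.triv K k) V)) →
        (∀ V : GaugeField (F.P K) k (Matrix.specialUnitaryGroup (Fin 2) ℂ),
          Real.exp (D.Ecst K k) * (Real.exp (-(D.Ecst K k) + D.Rm K k) * (D.up K k V - D.low K k V)) ≤
            Real.exp (-(prm (K - k)).cLF) * Real.exp (C₅ * Fintype.card (Site (F.P K) k))) →
        (∀ (V : GaugeField (F.P K) k (Matrix.specialUnitaryGroup (Fin 2) ℂ)) (S : Finset (Plaq (F.P K) k)),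
          (∀ p ∈ S, θBal F.L γ b₀ p₀ (K - k) ≤ GaugeGroup.dist1 (GaugeField.plaqHol V p)) →
            Real.exp (D.Ecst K k) *
                canonVersion (fieldMeasure (F.P K) k (Matrix.specialUnitaryGroup (Fin 2) ℂ)) (orbAvg (resDensity F γ K Set.univ k)) V ≤
              Real.exp (-((prm (K - k)).cLF * S.card)) * Real.exp (C₅ * Fintype.card (Site (F.P K) k))) →
        Mem (P := F.P K) (k := k) (fun i => BlockAveraging.blockAvg (P := F.P K) (j := i) ℰp) { prm (K - k) with β := (F.scheme ℰp γ).β K }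
          (fun V => Real.exp (D.Ecst K k) *
            canonVersion (fieldMeasure (F.P K) k (Matrix.specialUnitaryGroup (Fin 2) ℂ)) (orbAvg (resDensity F γ K Set.univ k)) V) := by
  have hA := h.base
  obtain ⟨κ₁, C, C', hts, hLC⟩ := h.commonRate
  obtain ⟨⟨C_R, q, hRm⟩, -⟩ := hA.2.1
  refine ⟨fun n =>
      { δ := θBal F.L γ b₀ p₀ n, δreg := R₀, δL := θBal F.L γ b₀ p₀ n, β := (F.L : ℝ) ^ n / γ, κ := κ₁, M := 2 * r + 18 * M₁ + 3 + CD,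
        Ccov := max C 0 * (2 * max C' 0 * (7 + 2 * r + 18 * M₁) ^ 3) * θBal F.L γ b₀ p₀ n ^ 2, cE := 0,
        slack := max C_R 0 * (2 * (F.L : ℝ) ^ F.m) ^ 3 / (1 - q) * q ^ n,
        cLF := B10.pFun (b₀ / 2) p₀ (Real.sqrt (γ * ((F.L : ℝ)⁻¹) ^ n)) ^ 2 / 4, c5 := C₅ },
    admissible_schedule F hts.1 hR₀ hRm.1 hRm.2.1 _ _ _ _, fun n => ⟨rfl, rfl, rfl, rfl, rfl, rfl, rfl⟩, ?_⟩
  intro K k hk hwin hlowc hupc hRegClass hlfle hlarge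
  have hdoor := mem_canonVersion_of_alphaRows D W hk hA.1.2.1 hA.1.2.2.1 hts hA.1.1 hA.admOnSmall hLC h.enlBounded h.locBlockVolume
    hA.2.2.2.2.2.1.2.1 hA.2.2.1 h.full.2.1 (hA.ineq47AE hk) (hA.ineq41AE hk) hr hM1 hMdvd hCD hγ.le hwin hlowc hupc
    (fun V hV => h.chiOneOnSmall K k V hk hV) (fun V v => h.trivWeight K k v V) (h.ztermTriv K k)
    (fun i _ _ Y hY => h.locBlockUnion K k (D.triv K k) i Y hY) (fun i _ _ Y hY x hx y hy => h.locDiam K k (D.triv K k) i Y hY x hx y hy)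
    h.enlContains hRegClass hlfle hlarge
  exact mem_schedule_of_mem_door D hγ hγ1 hγe hb hp hr hRm hk κ₁ R₀ C₅ _ hdoor

/-! ## §4 The same for the MAJORANT edition of the door (✓`…MemCanonMajorantOfRows`: `hupc` ↦ a window-continuous `G ≥ up`, `G ≥ low`) -/

/-- ★★★ **THE MAJORANT DOOR INTO THE ADMISSIBLE SCHEDULE** — as `mem_schedule_of_alphaFullTriv`, with ✓`…S1aAlphaMemCanonMajorantOfRows.mem_canonVersion_of_alphaRows_majorant`'s
(41)-side: SOME `G` with `low ≤ G` everywhere, `up ≤ G` and `G` continuous on the window, `lf := e^{E}·e^{−E+Rm}·(G − low)`; rows fed BY NAME from `AlphaInputsT3ACFullTriv`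
(`R0`∕`Z0`∕`LFSum`∕`ChiRange` not needed). [cite: Balaban1985UV3, (41)-(47) pp.266-267, (5) p.256, (7) p.257] -/
theorem mem_schedule_of_alphaFullTriv_majorant {D : AlphaDataT3 F γ} (W : LFData D) {b₀ p₀ ε₀ C68 Cχ B₃ r CD R₀ C₅ : ℝ} {M₁ : ℕ} {K k : ℕ} (hk : k ≤ K)
    (h : AlphaInputsT3ACFullTriv D W b₀ p₀ ε₀ C68 Cχ B₃ M₁ r CD) (hγ : 0 < γ) (hγ1 : γ ≤ 1) (hγe : Real.sqrt γ ≤ Real.exp (1 - p₀)) (hb : 0 ≤ b₀) (hp : 0 ≤ p₀)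
    (hr : 0 ≤ r) (hM1 : 1 ≤ M₁) (hMdvd : M₁ ∣ 2 * F.L ^ F.m) (hCD : 0 ≤ CD)
    (hwin : {V : GaugeField (F.P K) k (Matrix.specialUnitaryGroup (Fin 2) ℂ) | PlaqSmall (θBal F.L γ b₀ p₀ (K - k)) V} ⊆
      regSet (fieldMeasure (F.P K) k (Matrix.specialUnitaryGroup (Fin 2) ℂ)) (resDensity F γ K Set.univ k))
    (hlowc : ContinuousOn (D.low K k) {V | PlaqSmall (θBal F.L γ b₀ p₀ (K - k)) V})
    (G : GaugeField (F.P K) k (Matrix.specialUnitaryGroup (Fin 2) ℂ) → ℝ)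
    (hGlow : ∀ V : GaugeField (F.P K) k (Matrix.specialUnitaryGroup (Fin 2) ℂ), D.low K k V ≤ G V)
    (hupG : ∀ V : GaugeField (F.P K) k (Matrix.specialUnitaryGroup (Fin 2) ℂ), PlaqSmall (θBal F.L γ b₀ p₀ (K - k)) V → D.up K k V ≤ G V)
    (hGc : ContinuousOn G {V | PlaqSmall (θBal F.L γ b₀ p₀ (K - k)) V})
    (hRegClass : ∀ V : GaugeField (F.P K) k (Matrix.specialUnitaryGroup (Fin 2) ℂ), PlaqSmall (θBal F.L γ b₀ p₀ (K - k)) V →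
      IsBackground (fun i => BlockAveraging.blockAvg (P := F.P K) (j := i) ℰp) {U | PlaqSmall R₀ U} k V (D.Umin K k (D.triv K k) V))
    (hlfle : ∀ V : GaugeField (F.P K) k (Matrix.specialUnitaryGroup (Fin 2) ℂ),
      Real.exp (D.Ecst K k) * (Real.exp (-(D.Ecst K k) + D.Rm K k) * (G V - D.low K k V)) ≤
        Real.exp (-(B10.pFun (b₀ / 2) p₀ (Real.sqrt (γ * ((F.L : ℝ)⁻¹) ^ (K - k))) ^ 2 / 4)) * Real.exp (C₅ * Fintype.card (Site (F.P K) k)))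
    (hlarge : ∀ (V : GaugeField (F.P K) k (Matrix.specialUnitaryGroup (Fin 2) ℂ)) (S : Finset (Plaq (F.P K) k)),
      (∀ p ∈ S, θBal F.L γ b₀ p₀ (K - k) ≤ GaugeGroup.dist1 (GaugeField.plaqHol V p)) →
        Real.exp (D.Ecst K k) *
            canonVersion (fieldMeasure (F.P K) k (Matrix.specialUnitaryGroup (Fin 2) ℂ)) (orbAvg (resDensity F γ K Set.univ k)) V ≤
          Real.exp (-(B10.pFun (b₀ / 2) p₀ (Real.sqrt (γ * ((F.L : ℝ)⁻¹) ^ (K - k))) ^ 2 / 4 * S.card)) *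
            Real.exp (C₅ * Fintype.card (Site (F.P K) k))) :
    ∃ κ₁ C C' C_R q : ℝ, (TermSize D b₀ p₀ C κ₁ ∧ LocCover D κ₁ C' ∧ RmSize D C_R q) ∧
      Mem (P := F.P K) (k := k) (fun i => BlockAveraging.blockAvg (P := F.P K) (j := i) ℰp)
        { δ := θBal F.L γ b₀ p₀ (K - k), δreg := R₀, δL := θBal F.L γ b₀ p₀ (K - k), β := (F.scheme ℰp γ).β K, κ := κ₁, M := 2 * r + 18 * M₁ + 3 + CD,
          Ccov := max C 0 * (2 * max C' 0 * (7 + 2 * r + 18 * M₁) ^ 3) * θBal F.L γ b₀ p₀ (K - k) ^ 2, cE := 0,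
          slack := max C_R 0 * (2 * (F.L : ℝ) ^ F.m) ^ 3 / (1 - q) * q ^ (K - k),
          cLF := B10.pFun (b₀ / 2) p₀ (Real.sqrt (γ * ((F.L : ℝ)⁻¹) ^ (K - k))) ^ 2 / 4, c5 := C₅ }
        (fun V => Real.exp (D.Ecst K k) *
          canonVersion (fieldMeasure (F.P K) k (Matrix.specialUnitaryGroup (Fin 2) ℂ)) (orbAvg (resDensity F γ K Set.univ k)) V) := by
  have hA := h.base
  obtain ⟨κ₁, C, C', hts, hLC⟩ := h.commonRate
  obtain ⟨⟨C_R, q, hRm⟩, -⟩ := hA.2.1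
  refine ⟨κ₁, C, C', C_R, q, ⟨hts, hLC, hRm⟩, ?_⟩
  have hdoor := mem_canonVersion_of_alphaRows_majorant D hk hA.1.2.1 hA.1.2.2.1 hts hA.1.1 hA.admOnSmall hLC h.enlBounded h.locBlockVolume
    hA.2.2.2.2.2.1.2.1 (hA.ineq47AE hk) (hA.ineq41AE hk) hr hM1 hMdvd hCD hγ.le hwin hlowc G hGlow hupG hGc
    (fun V hV => h.chiOneOnSmall K k V hk hV)
    (fun i _ _ Y hY => h.locBlockUnion K k (D.triv K k) i Y hY) (fun i _ _ Y hY x hx y hy => h.locDiam K k (D.triv K k) i Y hY x hx y hy)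
    h.enlContains hRegClass hlfle hlarge
  exact mem_schedule_of_mem_door D hγ hγ1 hγe hb hp hr hRm hk κ₁ R₀ C₅ _ hdoor

end Summit.QuantumFields.YangMills.Theorems.FluctuationComparisonRegPrIntLS1aAlphaAdmissibleSchedule

end
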